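import Mathlib.GroupTheory.PresentedGroup
import Mathlib.GroupTheory.Perm.Fin
import Mathlib.Data.ZMod.Basic
import Mathlib.Algebra.BigOperators.Group.List.Basic
import Literature.GroupTheory.CombinatorialGroupTheory.PuncturedSurfaceGroup
import HarnessLib

/-!
# The cusp generators of the punctured surface group `Γ_{g,r}` are nontrivial

For a hyperbolic type `(g, r)` (`2g − 2 + r > 0`) every puncture generator `c_j` of
`Γ_{g,r} = ⟨a₁, b₁, …, a_g, b_g, c₁, …, c_r ∣ [a₁,b₁]⋯[a_g,b_g]·c₁⋯c_r⟩` (abc-iut-L3-t1's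
`PuncturedSurfaceGroup g r`, [SemiAnbd] Example 2.10 [cite: MochizukiSemiAnbd2006, Ex. 2.10 p.31]) is
nontrivial: for `r ≥ 2` it maps to the generator of `ℤ/2` under `c_j, c_{j'} ↦ 1`, everything else `↦ 0`
(the relator has even `c`-weight); for `r = 1` (so `g ≥ 1`) it maps to `[σ, τ]⁻¹ ≠ 1` in `S₃` under
`a₁ ↦ σ`, `b₁ ↦ τ`, `c₁ ↦ [σ,τ]⁻¹`.  Hence the cusp inertia subgroups `⟨c_j⟩` are infinite cyclic (free
groups being torsion-free) — the input "`I_i` is infinite" of [SemiAnbd] Ex. 2.10 / [AbsAnab] Lem. 1.3.7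
via `IsProSigmaCompletion.infinite_topologicalClosure_map_zpowers`.  Theorems only.
-/

namespace Literature.GroupTheory.CombinatorialGroupTheory.PuncturedSurfaceGroup

variable {g r : ℕ}

/-- The image of the relator of `Γ_{g,r}` under `FreeGroup.lift f` splits as the product of the images of
the commutator part and of the puncture part. [cite: MochizukiSemiAnbd2006, Ex. 2.10 p.31] -/
theorem lift_relator {M : Type*} [Group M] (f : puncturedSurfaceGen g r → M) :
    FreeGroup.lift f (relator g r) =
      ((List.finRange g).map fun i =>
          f (Sum.inl (i, false)) * f (Sum.inl (i, true)) * (f (Sum.inl (i, false)))⁻¹ *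
            (f (Sum.inl (i, true)))⁻¹).prod *
        ((List.finRange r).map fun j => f (Sum.inr j)).prod := by
  simp only [relator, map_mul, map_list_prod, List.map_map, Function.comp_def, map_inv, genA, genB,
    genC, FreeGroup.lift_apply_of]

/-- **The puncture generators are nontrivial**: for a hyperbolic type `(g, r)` and any `j`,
`c_j ≠ 1` in `Γ_{g,r}`. [cite: MochizukiSemiAnbd2006, Ex. 2.10 p.31] -/
theorem c_ne_one (h : IsHyperbolicType g r) (j : Fin r) : (c j : PuncturedSurfaceGroup g r) ≠ 1 := by
  classical
  unfold IsHyperbolicType at h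
  by_cases hr : ∃ j' : Fin r, j' ≠ j
  · -- `r ≥ 2`: the character `c_j, c_{j'} ↦ 1 ∈ ℤ/2`
    obtain ⟨j', hj'⟩ := hr
    let x : Multiplicative (ZMod 2) := Multiplicative.ofAdd 1
    let f : puncturedSurfaceGen g r → Multiplicative (ZMod 2) :=
      Sum.elim (fun _ => 1) fun k => (if k = j then x else 1) * (if k = j' then x else 1)
    have hrel : ∀ w ∈ ({relator g r} : Set (FreeGroup (puncturedSurfaceGen g r))),
        FreeGroup.lift f w = 1 := by
      intro w hw
      rw [Set.mem_singleton_iff] at hw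
      rw [hw, lift_relator]
      have h1 : ((List.finRange g).map fun i =>
          f (Sum.inl (i, false)) * f (Sum.inl (i, true)) * (f (Sum.inl (i, false)))⁻¹ *
            (f (Sum.inl (i, true)))⁻¹).prod = 1 :=
        List.prod_eq_one fun y hy => by
          obtain ⟨i, -, rfl⟩ := List.mem_map.mp hy
          simp [f]
      have h2 : ((List.finRange r).map fun k => f (Sum.inr k)).prod = 1 := by
        simp only [f, Sum.elim_inr]
        rw [List.prod_map_mul,
          List.prod_map_eq_pow_single j _ (fun k hk _ => if_neg hk),
          List.prod_map_eq_pow_single j' _ (fun k hk _ => if_neg hk),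
          List.count_finRange, List.count_finRange, if_pos rfl, if_pos rfl, pow_one]
        decide
      rw [h1, h2, one_mul]
    intro hc
    have himg := congrArg (PresentedGroup.toGroup hrel) hc
    rw [map_one, c, PresentedGroup.toGroup.of] at himg
    have hx : f (Sum.inr j) = x := by simp [f, Ne.symm hj']
    rw [hx] at himg
    exact absurd himg (by decide)
  · -- `r = 1` (so `g ≥ 1`): `a₁ ↦ σ`, `b₁ ↦ τ`, `c₁ ↦ [σ,τ]⁻¹` in `S₃`
    push Not at hr
    have hr1 : ∀ k : Fin r, k = j := hr
    have hg : 0 < g := by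
      have hr' : r ≤ 1 := by
        by_contra hle
        have h01 : (⟨0, by omega⟩ : Fin r) = ⟨1, by omega⟩ := (hr1 _).trans (hr1 _).symm
        simp [Fin.ext_iff] at h01
      omega
    let i₀ : Fin g := ⟨0, hg⟩
    let σ : Equiv.Perm (Fin 3) := Equiv.swap 0 1
    let τ : Equiv.Perm (Fin 3) := Equiv.swap 1 2
    let κ : Equiv.Perm (Fin 3) := σ * τ * σ⁻¹ * τ⁻¹
    let f : puncturedSurfaceGen g r → Equiv.Perm (Fin 3) :=
      Sum.elim (fun ib => if ib.1 = i₀ then (if ib.2 then τ else σ) else 1) fun _ => κ⁻¹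
    have hrel : ∀ w ∈ ({relator g r} : Set (FreeGroup (puncturedSurfaceGen g r))),
        FreeGroup.lift f w = 1 := by
      intro w hw
      rw [Set.mem_singleton_iff] at hw
      rw [hw, lift_relator]
      have h1 : ((List.finRange g).map fun i =>
          f (Sum.inl (i, false)) * f (Sum.inl (i, true)) * (f (Sum.inl (i, false)))⁻¹ *
            (f (Sum.inl (i, true)))⁻¹).prod = κ := by
        rw [List.prod_map_eq_pow_single i₀ _ (fun i hi _ => by simp [f, hi]), List.count_finRange,
          pow_one]
        simp [f, κ]
      have h2 : ((List.finRange r).map fun k => f (Sum.inr k)).prod = κ⁻¹ := by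
        rw [List.prod_map_eq_pow_single j _ (fun k hk _ => absurd (hr1 k) hk), List.count_finRange,
          pow_one]
        simp [f]
      rw [h1, h2, mul_inv_cancel]
    intro hc
    have himg := congrArg (PresentedGroup.toGroup hrel) hc
    rw [map_one, c, PresentedGroup.toGroup.of] at himg
    have hx : f (Sum.inr j) = κ⁻¹ := by simp [f]
    rw [hx] at himg
    exact absurd himg (by decide)

/-- The cusp inertia subgroup `⟨c_j⟩` is nontrivial. [cite: MochizukiSemiAnbd2006, Ex. 2.10 p.31] -/
theorem cuspInertia_ne_bot (h : IsHyperbolicType g r) (j : Fin r) :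
    (cuspInertia (g := g) j : Subgroup (PuncturedSurfaceGroup g r)) ≠ ⊥ := by
  rw [cuspInertia, Ne, Subgroup.zpowers_eq_bot]
  exact c_ne_one h j

end Literature.GroupTheory.CombinatorialGroupTheory.PuncturedSurfaceGroup
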